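import Literature.AlgebraicGeometry.ModuliOfAbelianVarieties.SiegelFineModuliSchemeClassifyDescIndependent
import Literature.AlgebraicGeometry.ModuliOfAbelianVarieties.SiegelFineModuliSchemeClassifyLevelQuotientExists
import Literature.AlgebraicGeometry.AbelianSchemes.PolarizedAbelianSchemeWithLevelBaseChangeCancel
import HarnessLib

/-!
# Uniqueness of the classifying map to a level quotient of a fine moduli carrier
# ([MumfordFogartyKirwan1994] Ch. 7 §3 pp. 139–142: `A_{g,d,n}/Γ` represents the coarser level functor — uniqueness half)

Topic `AlgebraicGeometry/ModuliOfAbelianVarieties`; namespace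
`Literature.AlgebraicGeometry.ModuliOfAbelianVarieties.SiegelFineModuliScheme`.  THEOREMS ONLY (no definition, no named
fact, no instance, no notation, no `sorry`; net Literature debt 0).  Cell `hodgecm-mathlib` (D-0151), F-DAG F-10 (b) TAIL,
brick **(b3) UNIQUENESS** (signature sheet `B-provers/B-p06/g11/F10b-CENSUS-SKELETON.B-p06g11.md` Addendum 4; author
B-p02 (g13)).  Count-neutral capital; HC_CM is proved only modulo the 7 printed citations until rung 0 closes — nothing
here is about HC.

SETTING.  `𝓜` a fine moduli carrier of level `N = N₀ d` (★ `SiegelFineModuliScheme`), `p : M → Q` a `ℚ`-morphism which is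
an fpqc cover (flat, surjective, quasi-compact; locally of finite type) killed by the twist operators of `K_δ(N₀)` (`hp`, the
currency of ★ `existsUnique_desc_classifyingMap_left_comp`), and `X` a level-`N₀` triple over `Q` of which the level-`N₀`
reduction `𝒰.changeLevel N₀` of the universal triple is the pull-back along `p` (the descended universal triple of (10a)).
CLAIM ([MumfordFogartyKirwan1994] Ch. 7 §3, proof of «`A_{g,d,n}/Γ` is the coarser moduli scheme», pp. 139–142;
[Lan2013PELCompactifications] Rem. 1.4.1.9): a `ℚ`-morphism `f : T → Q` from a locally Noetherian `T` along which a level-`N₀`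
triple `Y` is the pull-back of `X` is UNIQUE — it equals the descended classifying map of every refinement of `Y`
(★ `eq_desc_classifyingMap_left_comp_of_lift`), because `f` lifts over the fpqc cover `T ×_Q M → T` to `pr₂ : T ×_Q M → M`,
and over `T ×_Q M` the level-`N₀` reduction of `pr₂^* 𝒰` and the pull-back of `Y` are both pull-backs of `X` along the same
map `pr₂ ≫ p = pr₁ ≫ f`, hence related along `pr₁` (★ cancellation `PolarizedAbelianSchemeWithLevel.exists_isBaseChangeVia_of_comp`).

* `eq_desc_of_isBaseChangeVia_levelQuotient` — LIFTED-FORM INSTANCE: `f.left = f₁` for the descended map `f₁` of any fpqc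
  refinement `(T₁, c₁, P₁)` of `Y`.
* **`hom_ext_of_isBaseChangeVia_levelQuotient`** — UNIQUENESS: two `ℚ`-morphisms `f f' : T → Q` along each of which `Y` is a
  pull-back of `X` are EQUAL (a refinement with a descended map exists by ★ `exists_desc_classifyingMap`).  This is the
  uniqueness half of the `classify` field of the level-`N₀` carrier on `Q` ((pack)); existence is ★
  `exists_desc_classifyingMap` + (b2′).

NOT here: the quotient `Q = M/Δ` itself ((Q) `exists_levelGroupQuotient`), its flatness ((Q-free): the `Δ`-action is free),
the descended triple `X` on `Q` ((10a)), the relation (b2′), the packaging (pack) — all enter as HYPOTHESES (`p`, `hp`, `X`, `hX`).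

## References
* [MumfordFogartyKirwan1994] D. Mumford, J. Fogarty, F. Kirwan, *Geometric Invariant Theory*, 3rd ed. (1994), Ch. 7 §3
  (pp. 139–140; pp. 140–142), Ch. 7 §2 Definition 7.2 (p. 129).
* [Lan2013PELCompactifications] K.-W. Lan, *Arithmetic compactifications of PEL-type Shimura varieties* (2013), §1.4.1
  Remark 1.4.1.9 (p. 90).
* [GortzWedhorn2020] U. Görtz, T. Wedhorn, *Algebraic Geometry I*, 2nd ed. (2020), Thm. 14.72 (fpqc covers are
  effective epimorphisms), Prop. 4.16 (p. 101).
-/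

noncomputable section

open CategoryTheory CategoryTheory.Limits AlgebraicGeometry
open scoped MonObj

namespace Literature.AlgebraicGeometry.ModuliOfAbelianVarieties

open Literature.AlgebraicGeometry.Motives (SchemeOver)
open Literature.AlgebraicGeometry.AbelianSchemes (PolarizedAbelianSchemeWithLevel)
open Literature.AlgebraicGeometry.AbelianSchemes.AbelianSchemeOver
open Literature.NumberTheory.Adeles NumberField IsDedekindDomain

namespace SiegelFineModuliScheme

variable {g N : ℕ} {δ : Fin g → ℕ} (𝓜 : SiegelFineModuliScheme g N δ) [IsCommMonObj 𝓜.univ.A.X] [NeZero N]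

/-- **A MORPHISM TO THE LEVEL QUOTIENT CLASSIFYING `Y` IS THE DESCENDED CLASSIFYING MAP** ([MumfordFogartyKirwan1994]
Ch. 7 §3 pp. 139–142; lifted form ★ `eq_desc_classifyingMap_left_comp_of_lift` instantiated at `T′ := T ×_Q M`,
`f̃ := pr₂`): `p : M → Q` an fpqc cover killed by the twist operators of `K_δ(N₀)`, `X` a level-`N₀` triple over `Q` with
`𝒰.changeLevel N₀ ≅ p^* X`, `f : T → Q` with `Y ≅ f^* X`; then `f` equals the descended map `f₁` of every fpqc refinement
`(T₁, c₁, P₁)` of `Y` (`c₁ ≫ f₁ = classifyingMap P₁ ≫ p`).  The lift clause — the level-`N₀` reduction of `pr₂^* 𝒰` is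
the pull-back of `Y` along `pr₁` — holds because both are pull-backs of `X` along `pr₂ ≫ p = pr₁ ≫ f`
(★ `IsBaseChangeVia.changeLevel` / `.trans`, Mathlib `pullback.condition`) and pull-back relations cancel
(★ `PolarizedAbelianSchemeWithLevel.exists_isBaseChangeVia_of_comp`).
[cite: MumfordFogartyKirwan1994, Ch. 7 §3 (pp. 139–140)] [cite: Lan2013PELCompactifications, §1.4.1 Remark 1.4.1.9 (p. 90)] -/
theorem eq_desc_of_isBaseChangeVia_levelQuotient (hδ : IsPolarizationType δ) (hg : 0 < g)
    {N₀ d : ℕ} [NeZero N₀] (hd : N = N₀ * d) {Q T T₁ : SchemeOver ℚ} [IsLocallyNoetherian T.left]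
    [IsLocallyNoetherian T₁.left] (p : 𝓜.M ⟶ Q) [Surjective p.left] [Flat p.left] [QuasiCompact p.left]
    [LocallyOfFiniteType p.left]
    (hp : ∀ r : gspFinAdelic δ, r ∈ principalLevelSubgroup δ N₀ → ∀ GN : GL (Fin g ⊕ Fin g) (ZMod N),
      (∀ (i j : Fin g ⊕ Fin g)
        (h : ((r : GL (Fin g ⊕ Fin g) finAdeleQ) : Matrix (Fin g ⊕ Fin g) (Fin g ⊕ Fin g) finAdeleQ) i j ∈
          FiniteAdeleRing.integralAdeles (𝓞 ℚ) ℚ),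
        (GN : Matrix (Fin g ⊕ Fin g) (Fin g ⊕ Fin g) (ZMod N)) i j = integralAdeleResidue N ⟨_, h⟩) →
      ∀ hs : (𝓜.univ.level.twist GN).IsSymplecticLiftable 𝓜.univ.pol δ,
        (haveI := 𝓜.isLocallyNoetherian
         (𝓜.classifyingMap 𝓜.M ({ 𝓜.univ with level := 𝓜.univ.level.twist GN, symplectic := hs } :
           PolarizedAbelianSchemeWithLevel g N δ 𝓜.M.left)).left) ≫ p.left = p.left)
    (X : PolarizedAbelianSchemeWithLevel g N₀ δ Q.left)
    {π : (𝓜.univ.changeLevel N₀ d hd (NeZero.ne N)).A.X.left ⟶ X.A.X.left}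
    {πh : (𝓜.univ.changeLevel N₀ d hd (NeZero.ne N)).D.hat.X.left ⟶ X.D.hat.X.left}
    (hX : (𝓜.univ.changeLevel N₀ d hd (NeZero.ne N)).IsBaseChangeVia X p.left π πh)
    {Y : PolarizedAbelianSchemeWithLevel g N₀ δ T.left} (f : T ⟶ Q)
    {G : Y.A.X.left ⟶ X.A.X.left} {Ĝ : Y.D.hat.X.left ⟶ X.D.hat.X.left} (hf : Y.IsBaseChangeVia X f.left G Ĝ)
    (c₁ : T₁ ⟶ T) [Surjective c₁.left] [Flat c₁.left] [QuasiCompact c₁.left]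
    (P₁ : PolarizedAbelianSchemeWithLevel g N δ T₁.left)
    {G₁ : P₁.A.X.left ⟶ Y.A.X.left} {Ĝ₁ : P₁.D.hat.X.left ⟶ Y.D.hat.X.left}
    (hY₁ : (P₁.changeLevel N₀ d hd (NeZero.ne N)).IsBaseChangeVia Y c₁.left G₁ Ĝ₁)
    (f₁ : T.left ⟶ Q.left) (hf₁ : c₁.left ≫ f₁ = (𝓜.classifyingMap T₁ P₁).left ≫ p.left) : f.left = f₁ := by
  haveI := 𝓜.isLocallyNoetherian
  -- the fpqc cover `T′ := T ×_Q M → T` with its lift `f̃ := pr₂ : T′ → M`, as `ℚ`-schemes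
  let K : Scheme := pullback f.left p.left
  let T' : SchemeOver ℚ := Over.mk (pullback.fst f.left p.left ≫ T.hom)
  let c : T' ⟶ T := Over.homMk (pullback.fst f.left p.left) rfl
  let ft : T' ⟶ 𝓜.M := Over.homMk (pullback.snd f.left p.left) (by
    change pullback.snd f.left p.left ≫ 𝓜.M.hom = pullback.fst f.left p.left ≫ T.hom
    rw [← Over.w p, ← Category.assoc, ← pullback.condition, Category.assoc, Over.w f])
  haveI : Surjective c.left := inferInstanceAs (Surjective (pullback.fst f.left p.left))
  haveI : Flat c.left := inferInstanceAs (Flat (pullback.fst f.left p.left))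
  haveI : QuasiCompact c.left := inferInstanceAs (QuasiCompact (pullback.fst f.left p.left))
  haveI : LocallyOfFiniteType c.left := inferInstanceAs (LocallyOfFiniteType (pullback.fst f.left p.left))
  haveI : IsLocallyNoetherian K := LocallyOfFiniteType.isLocallyNoetherian (pullback.fst f.left p.left)
  haveI : IsLocallyNoetherian T'.left := inferInstanceAs (IsLocallyNoetherian K)
  -- the lift clause: `(pr₂^* 𝒰).changeLevel N₀` and `pr₁^* Y` are both pull-backs of `X` along `pr₂ ≫ p = pr₁ ≫ f`
  have h₁ := ((𝓜.univ.baseChange_isBaseChangeVia ft.left).changeLevel N₀ d hd (NeZero.ne N)).trans hX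
  have hcond : ft.left ≫ p.left = c.left ≫ f.left := pullback.condition.symm
  rw [hcond] at h₁
  obtain ⟨m, mh, -, -, hlift⟩ := PolarizedAbelianSchemeWithLevel.exists_isBaseChangeVia_of_comp h₁ hf
  exact 𝓜.eq_desc_classifyingMap_left_comp_of_lift hδ hg hd c c₁ ft hlift P₁ hY₁ p.left hp f.left f₁
    pullback.condition hf₁

/-- **UNIQUENESS OF THE CLASSIFYING MAP TO THE LEVEL QUOTIENT** ([MumfordFogartyKirwan1994] Ch. 7 §3 pp. 139–142:
«`A_{g,d,n}/Γ` is the coarser fine moduli scheme» — the uniqueness half of its `classify`; [Lan2013PELCompactifications]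
Rem. 1.4.1.9).  `p : M → Q` an fpqc cover (flat, surjective, quasi-compact, locally of finite type) killed by the twist
operators of `K_δ(N₀)`, `X` a level-`N₀` triple over `Q` with `𝒰.changeLevel N₀ ≅ p^* X`: if a level-`N₀` triple `Y` over
a locally Noetherian `ℚ`-scheme `T` is a pull-back of `X` along BOTH `f` and `f′ : T → Q`, then `f = f′` — each equals the
descended classifying map of one finite étale refinement of `Y` (★ `exists_desc_classifyingMap`,
`eq_desc_of_isBaseChangeVia_levelQuotient`).
[cite: MumfordFogartyKirwan1994, Ch. 7 §3 (pp. 139–140)] [cite: Lan2013PELCompactifications, §1.4.1 Remark 1.4.1.9 (p. 90)] -/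
theorem hom_ext_of_isBaseChangeVia_levelQuotient (hδ : IsPolarizationType δ) (hg : 0 < g)
    {N₀ d : ℕ} [NeZero N₀] (hd : N = N₀ * d) {Q T : SchemeOver ℚ} [IsLocallyNoetherian T.left]
    (p : 𝓜.M ⟶ Q) [Surjective p.left] [Flat p.left] [QuasiCompact p.left] [LocallyOfFiniteType p.left]
    (hp : ∀ r : gspFinAdelic δ, r ∈ principalLevelSubgroup δ N₀ → ∀ GN : GL (Fin g ⊕ Fin g) (ZMod N),
      (∀ (i j : Fin g ⊕ Fin g)
        (h : ((r : GL (Fin g ⊕ Fin g) finAdeleQ) : Matrix (Fin g ⊕ Fin g) (Fin g ⊕ Fin g) finAdeleQ) i j ∈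
          FiniteAdeleRing.integralAdeles (𝓞 ℚ) ℚ),
        (GN : Matrix (Fin g ⊕ Fin g) (Fin g ⊕ Fin g) (ZMod N)) i j = integralAdeleResidue N ⟨_, h⟩) →
      ∀ hs : (𝓜.univ.level.twist GN).IsSymplecticLiftable 𝓜.univ.pol δ,
        (haveI := 𝓜.isLocallyNoetherian
         (𝓜.classifyingMap 𝓜.M ({ 𝓜.univ with level := 𝓜.univ.level.twist GN, symplectic := hs } :
           PolarizedAbelianSchemeWithLevel g N δ 𝓜.M.left)).left) ≫ p.left = p.left)
    (X : PolarizedAbelianSchemeWithLevel g N₀ δ Q.left)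
    {π : (𝓜.univ.changeLevel N₀ d hd (NeZero.ne N)).A.X.left ⟶ X.A.X.left}
    {πh : (𝓜.univ.changeLevel N₀ d hd (NeZero.ne N)).D.hat.X.left ⟶ X.D.hat.X.left}
    (hX : (𝓜.univ.changeLevel N₀ d hd (NeZero.ne N)).IsBaseChangeVia X p.left π πh)
    {Y : PolarizedAbelianSchemeWithLevel g N₀ δ T.left} (f f' : T ⟶ Q)
    {G : Y.A.X.left ⟶ X.A.X.left} {Ĝ : Y.D.hat.X.left ⟶ X.D.hat.X.left} (hf : Y.IsBaseChangeVia X f.left G Ĝ)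
    {G' : Y.A.X.left ⟶ X.A.X.left} {Ĝ' : Y.D.hat.X.left ⟶ X.D.hat.X.left} (hf' : Y.IsBaseChangeVia X f'.left G' Ĝ') :
    f = f' := by
  have hd0 : d ≠ 0 := fun h => NeZero.ne N (by rw [hd, h, Nat.mul_zero])
  subst hd
  -- one finite étale refinement of `Y` with its descended map `f₁`
  obtain ⟨T₁, c₁, _, P₁, G₁, Ĝ₁, f₁, hfin, het, hsurj, hY₁, hf₁⟩ := 𝓜.exists_desc_classifyingMap hδ hg hd0 T Y p.left hp
  haveI := hfin
  haveI := het
  haveI := hsurj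
  ext : 1
  rw [𝓜.eq_desc_of_isBaseChangeVia_levelQuotient hδ hg rfl p hp X hX f hf c₁ P₁ hY₁ f₁ hf₁,
    𝓜.eq_desc_of_isBaseChangeVia_levelQuotient hδ hg rfl p hp X hX f' hf' c₁ P₁ hY₁ f₁ hf₁]

end SiegelFineModuliScheme

end Literature.AlgebraicGeometry.ModuliOfAbelianVarieties

end
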